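import Summits.Ventures.QEC.Census.BB.BB72Rank
import Summits.Ventures.QEC.Theses.BB72DistanceCertificate
import HarnessLib

/-!
# Route BB72DistanceCertificate, item `TwelveLogicalQubits` (stmt-Ventures-19879): `BB.bb72.k = 12`

Closer of the support item `TwelveLogicalQubits : (BB.bb72).k = 12` of route
`Summits/Ventures/QEC/Theses/BB72DistanceCertificate.lean` (LADDER-QEC rung Q2, the `[[72,12,6]]` benchmark of
Bravyi–Cross–Gambetta–Maslov–Rall–Yoder 2024): the dimension of the typed bivariate-bicycle code
`QC(x³+y+y², y³+x+x²)` on `ℤ₆ × ℤ₆` is `k = n − rank H^X − rank H^Z = 72 − 30 − 30 = 12`, the two ranks being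
established by kernel-checked RANK CERTIFICATES (`Summits/Ventures/QEC/Census/BB/BB72Rank.lean`: CERT-FORMAT v1 §3
`k_cert`, checker `RankCert.check` by `decide`, soundness `rank_rowMatrix_of_check`; matrices identified with
`BB.bb72.HXFlat/HZFlat` by type-05's index identity). This file only re-states `Census.bb72_k` at the route
declaration's type; it is the one file of the item allowed to import the Theses module (cell build rule).
Tier KERNEL: axioms ⊆ {propext, Classical.choice, Quot.sound}.
-/

namespace Summit.Ventures.QEC.Theorems

/-- **`k(BB72) = 12`** — route item `TwelveLogicalQubits` (stmt-Ventures-19879) of route BB72DistanceCertificate,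
discharged by the kernel-checked rank certificates of `Census/BB/BB72Rank.lean` (`Census.bb72_k`).
[cite: BravyiEtAl2024, §3 Table 1 row [[72,12,6]] and §4 Lemma 1 (arXiv:2308.07915 chunk p0009 L63-83: k = n − rk H^X − rk H^Z)] -/
theorem TwelveLogicalQubits_proof : Summit.Ventures.QEC.Theses.BB72DistanceCertificate.TwelveLogicalQubits := by
  unfold Summit.Ventures.QEC.Theses.BB72DistanceCertificate.TwelveLogicalQubits
  exact Summit.Ventures.QEC.Census.bb72_k

end Summit.Ventures.QEC.Theorems
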